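import Literature.NumberTheory.EllipticCurves.KatoFineSelmerDualProofs
import Literature.NumberTheory.EllipticCurves.IwasawaNakayamaProofs
import HarnessLib

/-!
# The dual fine Selmer group `X₀(E/K_∞)`: `X₀/(p)X₀` finite ⟸ `Sel₀(K_∞, E[p^∞])[p]` finite, and finite
# generation from `Sel₀[𝔪]` (Pontryagin algebra, proved; no named fact)

Second sibling proof file of `KatoFineSelmerDual` (structure `WeierstrassCurve.FineSelmerDualData W κ γ`
= `X₀ = Hom(Sel₀(K_∞, E[p^∞]), ℚ/ℤ)` as an abstract `Λ = ℤ_p⟦T⟧`-module with `toDual`, `toDual_T_smul`,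
`toDual_C_smul`; constructed in `KatoFineSelmerDualProofs`, `WeierstrassCurve.fineSelmerDualData`).
Cell `bsd-smallim` (rung K6 of `BirchSwinnertonDyer`, class X9, route `SmallImageMuTransfer`, crux
`MuTransferX9` = item 19276), seat `bsd-smallim-k6-c2`: the crux's re-targeted obligation (seat k6-ty,
file `Kato2004/DivisibilityInputsFine`) is "`μ(X₀(E/ℚ_∞)) = 0`", and a Kolyvagin/Euler-system argument
with `E[p]`-coefficients over `ℚ_∞` produces "`Sel₀(ℚ_∞, E[p^∞])[p]` is finite".  This file supplies
the conversion, WITHOUT any named fact: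

* `IwasawaDual.exists_eq_comp_nsmul_of_forall_pTorsion`, `exists_eq_C_p_smul_of_forall_pTorsion`,
  `finite_quotient_pSmul_of_finite_pTorsion` (generic, axiomatic Pontryagin duality as in
  `IwasawaNakayamaProofs`): for a group isomorphism `toDual : X ≃ Hom(S, ℚ/ℤ)` with constants
  `c ∈ ℤ_p` acting through `ℤ_p → ℤ/p^k` on `p^k`-torsion classes and `S` `p`-primary, the annihilator
  of `S[p]` in `X` is `(p)·X` (exactness of Pontryagin duality `(X/pX)^∨ = S[p]`, via the injectivity of
  `ℚ/ℤ`, Mathlib `CharacterModule.dual_surjective_of_injective`), so `X/(p)X ↪ Maps(S[p], ℚ/ℤ[p])` and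
  `X/(p)X` is finite when `S[p]` is (`AddCircle.finite_torsion`);
* `WeierstrassCurve.FineSelmerDualData.isDualPair`, `.module_finite_of_finite` (Nakayama for duals,
  `IsDualPair.module_finite`: `X₀` is finitely generated over `Λ` once `Sel₀[𝔪]` is finite — in
  particular once `Sel₀[p]` is, `.module_finite_of_finite_pTorsion`) and
  `.finite_quotient_augIdealP_of_finite_pTorsion`: **`Sel₀(K_∞, E[p^∞])[p]` finite ⟹ `X₀/(p)X₀`
  finite** (hence `length_{(p)} X₀ = 0`, i.e. `μ(X₀) = 0`).

HONEST FRAMING: theorems only; nothing asserted; BSD is not advanced (the consumer's closes are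
rung-level and conditional on named facts).

References: R. Greenberg, LNM 1716 (1999), §1 p. 60 ("`X/𝔪X` is finite … Nakayama"); S. Lang,
*Cyclotomic Fields I and II*, Ch. 5 §1; B. Mazur, Invent. Math. 18 (1972) §6; J. Coates, R. Sujatha,
Math. Ann. 331 (2005) §3.
-/

noncomputable section

open Literature.NumberTheory.EllipticCurves

namespace Literature.NumberTheory.EllipticCurves

namespace IwasawaDual

/-! ## Part 1: `X/(p)X ↪ Maps(S[p], ℚ/ℤ[p])` for an axiomatic Pontryagin dual -/
section PTorsion

variable {p : ℕ} [Fact p.Prime]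
variable {S : Type*} [AddCommGroup S]
variable {X : Type*} [AddCommGroup X] [Module (PowerSeries ℤ_[p]) X]
variable {toDual : X →+ (S →+ AddCircle (1 : ℚ))}

omit [Fact p.Prime] in
/-- **Exactness of Pontryagin duality at `p`: a character killing `S[p]` is `p` times a character.**
If `χ : S → ℚ/ℤ` vanishes on `S[p] = ker (p·)`, it factors through the image `pS` of
multiplication by `p` and extends from `pS ≤ S` to `S` (injectivity of `ℚ/ℤ`, Mathlib
`CharacterModule.dual_surjective_of_injective`): `χ = χ' ∘ (p·)` — the exactness of Pontryagin duality
`(pS)^∨ = S^∨/ann` used by Greenberg for `X/𝔪X ↔ Sel[𝔪]`. [cite: GreenbergLNM1716, §1 p. 60 (after Conj. 1.3)] -/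
theorem exists_eq_comp_nsmul_of_forall_pTorsion (χ : S →+ AddCircle (1 : ℚ))
    (hχ : ∀ s : S, p • s = 0 → χ s = 0) :
    ∃ χ' : S →+ AddCircle (1 : ℚ), ∀ s, χ s = χ' (p • s) := by
  let δ : S →+ S := DistribSMul.toAddMonoidHom S (p : ℕ)
  have hδ : ∀ s, δ s = p • s := fun s ↦ rfl
  have hker : δ.rangeRestrict.ker ≤ χ.ker := by
    intro s hs
    rw [AddMonoidHom.mem_ker] at hs ⊢
    have hs' : δ s = 0 := congrArg (fun z : δ.range ↦ (z : S)) hs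
    exact hχ s hs'
  have hsurj : Function.Surjective δ.rangeRestrict := AddMonoidHom.rangeRestrict_surjective δ
  let χ₁ : δ.range →+ AddCircle (1 : ℚ) := δ.rangeRestrict.liftOfSurjective hsurj ⟨χ, hker⟩
  have hχ₁ : ∀ s, χ₁ (δ.rangeRestrict s) = χ s := fun s ↦
    AddMonoidHom.liftOfRightInverse_comp_apply _ _ _ _ s
  obtain ⟨y, hy⟩ := CharacterModule.dual_surjective_of_injective
    (δ.range.subtype.toIntLinearMap) (fun a b hab ↦ Subtype.ext hab) χ₁
  have hy' : ∀ g : δ.range, y g = χ₁ g := fun g ↦ by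
    have := DFunLike.congr_fun hy g
    rw [CharacterModule.dual_apply] at this
    exact this
  refine ⟨y, fun s ↦ ?_⟩
  rw [← hχ₁ s, ← hy']
  rfl

/-- **The annihilator of `S[p]` is `(p)·X`** for an axiomatic Pontryagin dual: if `toDual` is
bijective, constants `c ∈ ℤ_p` act through `ℤ_p → ℤ/p^k` on `p^k`-torsion classes and `S` is
`p`-primary, then an `x ∈ X` whose character kills `S[p]` lies in `C(p)·X`.  Proof: `toDual x = χ' ∘ p`
(`exists_eq_comp_nsmul_of_forall_pTorsion`), `χ' = toDual x'`, and `toDual (C p · x') s = p·(toDual x' s)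
= toDual x' (p s)` on every `p`-power-torsion `s`. [cite: GreenbergLNM1716, §1 p. 60 (after Conj. 1.3)] -/
theorem exists_eq_C_p_smul_of_forall_pTorsion (hbij : Function.Bijective toDual)
    (hC : ∀ (c : ℤ_[p]) (x : X) (s : S) (k : ℕ), p ^ k • s = 0 →
      toDual (PowerSeries.C c • x) s = (PadicInt.toZModPow k c).val • toDual x s)
    (htor : ∀ s : S, ∃ k : ℕ, p ^ k • s = 0) {x : X} (hx : ∀ s : S, p • s = 0 → toDual x s = 0) :
    ∃ x' : X, x = PowerSeries.C (p : ℤ_[p]) • x' := by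
  obtain ⟨χ', hχ'⟩ := exists_eq_comp_nsmul_of_forall_pTorsion (toDual x) hx
  obtain ⟨x', hx'⟩ := hbij.2 χ'
  refine ⟨x', hbij.1 ?_⟩
  ext s
  obtain ⟨k, hk⟩ := htor s
  -- use the level `k + 1 ≥ 1`, where `(p mod p^{k+1}).val • t = p • t` on `p^{k+1}`-torsion
  have hk1 : p ^ (k + 1) • s = 0 := by rw [pow_succ', mul_smul, hk, smul_zero]
  rw [hC (p : ℤ_[p]) x' s (k + 1) hk1, hχ' s, ← hx', map_nsmul]
  -- `(toZModPow (k+1) p).val • χ' s = p • χ' s` since both agree mod `p^{k+1}` and `p^{k+1} χ' s = 0`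
  have hval : (PadicInt.toZModPow (k + 1) (p : ℤ_[p])).val ≡ p [MOD p ^ (k + 1)] := by
    rw [map_natCast, ZMod.val_natCast]
    exact Nat.mod_modEq p (p ^ (k + 1))
  have hps : p ^ (k + 1) • (toDual x') s = 0 := by rw [← map_nsmul, hk1, map_zero]
  exact (smul_eq_of_modEq hps hval).symm

/-- **`X/(p)X` is finite when `S[p]` is** (axiomatic Pontryagin dual, `S` `p`-primary): restriction of
characters to `S[p]` has kernel `⊆ (p)·X` (`exists_eq_C_p_smul_of_forall_pTorsion`), and
`Hom(S[p], ℚ/ℤ)` embeds into the finite set of maps `S[p] → ℚ/ℤ[p]` (`AddCircle.finite_torsion`).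
Greenberg (1999) §1 p. 60 (the dual statement "`X/𝔪X` finite" for `𝔪`); here for the ideal `(p)`.
[cite: GreenbergLNM1716, §1 p. 60 (after Conj. 1.3)] -/
theorem finite_quotient_pSmul_of_finite_pTorsion (hbij : Function.Bijective toDual)
    (hC : ∀ (c : ℤ_[p]) (x : X) (s : S) (k : ℕ), p ^ k • s = 0 →
      toDual (PowerSeries.C c • x) s = (PadicInt.toZModPow k c).val • toDual x s)
    (htor : ∀ s : S, ∃ k : ℕ, p ^ k • s = 0) (hfin : {s : S | p • s = 0}.Finite) :
    Finite (X ⧸ (Ideal.span {PowerSeries.C (p : ℤ_[p])} • ⊤ :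
      Submodule (PowerSeries ℤ_[p]) X)) := by
  classical
  -- the finite target: functions `S[p] → {u : ℚ/ℤ | p • u = 0}`
  set Sp : Set S := {s : S | p • s = 0} with hSp
  haveI : Finite Sp := hfin.to_subtype
  have hT : {u : AddCircle (1 : ℚ) | p • u = 0}.Finite :=
    AddCircle.finite_torsion (1 : ℚ) (Fact.out : p.Prime).pos
  haveI : Finite {u : AddCircle (1 : ℚ) | p • u = 0} := hT.to_subtype
  -- the restriction map `X → (Sp → torsion)`
  let ρ : X → (Sp → {u : AddCircle (1 : ℚ) | p • u = 0}) := fun x s ↦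
    ⟨toDual x s, by
      change p • toDual x (s : S) = 0
      rw [← map_nsmul, s.2, map_zero]⟩
  set N : Submodule (PowerSeries ℤ_[p]) X := Ideal.span {PowerSeries.C (p : ℤ_[p])} • ⊤ with hN
  -- `ρ` is constant on cosets of `N`... rather: `ρ x = ρ y → x - y ∈ N`
  have hkey : ∀ x y : X, ρ x = ρ y → x - y ∈ N := by
    intro x y hxy
    have hann : ∀ s : S, p • s = 0 → toDual (x - y) s = 0 := by
      intro s hs
      have := congrArg (fun f ↦ ((f ⟨s, hs⟩ : {u : AddCircle (1 : ℚ) | p • u = 0}) : AddCircle (1 : ℚ)))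
        hxy
      simp only [ρ] at this
      rw [map_sub, AddMonoidHom.sub_apply, this, sub_self]
    obtain ⟨x', hx'⟩ := exists_eq_C_p_smul_of_forall_pTorsion hbij hC htor hann
    rw [hx', hN]
    exact Submodule.smul_mem_smul (Ideal.mem_span_singleton_self _) Submodule.mem_top
  -- hence the quotient map factors: `X ⧸ N` injects into the finite function type
  refine Finite.of_injective (fun q : X ⧸ N ↦ Quotient.liftOn' q ρ ?_) ?_
  · intro x y hxy
    -- `x - y ∈ N ⟹ ρ x = ρ y`: elements of `N = (p)·X` have characters vanishing on `S[p]`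
    have hxyN : x - y ∈ N := (Submodule.quotientRel_def N).mp hxy
    funext s
    apply Subtype.ext
    change toDual x s = toDual y s
    rw [← sub_eq_zero, ← AddMonoidHom.sub_apply, ← map_sub]
    -- characters of `N` kill `S[p]`
    have hNann : ∀ z ∈ N, toDual z (s : S) = 0 := by
      intro z hz
      rw [hN] at hz
      refine Submodule.smul_induction_on hz (fun a ha n _ ↦ ?_) (fun a b ha hb ↦ ?_)
      · obtain ⟨r, rfl⟩ := Ideal.mem_span_singleton'.mp ha
        rw [mul_comm, mul_smul, hC (p : ℤ_[p]) (r • n) s 1 (by rw [pow_one]; exact s.2)]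
        have h0 : (PadicInt.toZModPow 1 (p : ℤ_[p])).val = 0 := by
          rw [map_natCast, ZMod.val_natCast, pow_one, Nat.mod_self]
        rw [h0, zero_smul]
      · rw [map_add, AddMonoidHom.add_apply, ha, hb, add_zero]
    exact hNann _ hxyN
  · intro q₁ q₂ hq
    induction q₁ using Quotient.inductionOn' with | h x => ?_
    induction q₂ using Quotient.inductionOn' with | h y => ?_
    exact (Submodule.Quotient.eq N).mpr (hkey x y hq)

end PTorsion

end IwasawaDual

end Literature.NumberTheory.EllipticCurves

/-! ## Part 2: the dual fine Selmer datum — `Sel₀[p]` finite ⟹ `X₀/(p)X₀` finite -/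

namespace WeierstrassCurve

open scoped Classical
open Literature.NumberTheory.EllipticCurves Literature.NumberTheory.GaloisRepresentations

universe u

variable {K : Type u} [Field K] [NumberField K] {W : WeierstrassCurve K} {p : ℕ} [Fact p.Prime]
  {κ : ZpExtension K p}

/-- Every class of `Sel₀(K_∞, E[p^∞])` is killed by a power of `p` (it is a class of
`H¹(K_∞, E[p^∞])`, `exists_pow_smul_subgroupH1_ker_eq_zero`). [cite: GreenbergLNM1716, §1 (after Conj. 1.3)] -/
theorem exists_pow_smul_fineSelmerInfty_eq_zero (s : W.fineSelmerInfty κ) : ∃ k : ℕ, p ^ k • s = 0 := by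
  obtain ⟨k, hk⟩ := W.exists_pow_smul_subgroupH1_ker_eq_zero κ (s : W.subgroupH1 p κ.kerSubgroup)
  exact ⟨k, Subtype.ext (by rw [AddSubgroupClass.coe_nsmul]; exact hk)⟩

namespace FineSelmerDualData

variable {γ : Field.absoluteGaloisGroup K} (Y : W.FineSelmerDualData κ γ)

/-- Every dual fine Selmer datum is a dual pair for `ψ = conj_γ − 1` on `Sel₀` (the fields of the
structure + `isLocNil_conjFineSelmerInfty_sub_one`). [cite: GreenbergLNM1716, §1 (after Conj. 1.3)] -/
theorem isDualPair (hγ : κ.IsTopGenerator γ) :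
    IwasawaDual.IsDualPair p (W.conjFineSelmerInfty κ γ - 1) Y.toDual where
  bijective := Y.bijective
  T_smul x s := by
    rw [Y.toDual_T_smul, IwasawaDual.End_sub_apply, AddMonoid.End.one_apply, map_sub]
    rfl
  C_smul c x s k hk := Y.toDual_C_smul c x s k hk
  locNil := W.isLocNil_conjFineSelmerInfty_sub_one κ hγ

/-- **`X₀(E/K_∞)` is finitely generated over `Λ` as soon as `Sel₀[𝔪] = {s | p s = 0, conj_γ s = s}` is
finite** (Nakayama for duals, `IsDualPair.module_finite`). [cite: GreenbergLNM1716, §1 p. 60 (after Conj. 1.3)] -/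
theorem module_finite_of_finite (hγ : κ.IsTopGenerator γ)
    (hfin : Set.Finite {s : W.fineSelmerInfty κ |
      p • s = 0 ∧ W.conjH1 p κ.kerSubgroup γ (s : W.subgroupH1 p κ.kerSubgroup) = s}) :
    Module.Finite (IwasawaAlgebra p) Y.X := by
  refine (Y.isDualPair hγ).module_finite ?_
  refine hfin.subset fun s hs ↦ ?_
  obtain ⟨hs1, hs2⟩ := hs
  rw [pow_one] at hs1 hs2
  refine ⟨hs1, ?_⟩
  rw [IwasawaDual.End_sub_apply, AddMonoid.End.one_apply, sub_eq_zero] at hs2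
  exact congrArg (fun z : W.fineSelmerInfty κ ↦ (z : W.subgroupH1 p κ.kerSubgroup)) hs2

/-- In particular `X₀` is finitely generated over `Λ` once `Sel₀(K_∞, E[p^∞])[p]` is finite.
[cite: GreenbergLNM1716, §1 p. 60 (after Conj. 1.3)] -/
theorem module_finite_of_finite_pTorsion (hγ : κ.IsTopGenerator γ)
    (hfin : Set.Finite {s : W.fineSelmerInfty κ | p • s = 0}) :
    Module.Finite (IwasawaAlgebra p) Y.X :=
  Y.module_finite_of_finite hγ (hfin.subset fun _ hs ↦ hs.1)

/-- **`Sel₀(K_∞, E[p^∞])[p]` finite ⟹ `X₀/(p)X₀` finite** (so `length_{(p)} X₀ = 0` and `μ(X₀) = 0`):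
`IwasawaDual.finite_quotient_pSmul_of_finite_pTorsion` for the datum `Y` (`(p) = augIdealP p`).
This is the conversion from the output of a Kolyvagin/Euler-system argument with `E[p]`-coefficients
over `K_∞` to the `μ`-invariant of the dual fine Selmer group. [cite: GreenbergLNM1716, §1 p. 60 (after Conj. 1.3)] -/
theorem finite_quotient_augIdealP_of_finite_pTorsion
    (hfin : Set.Finite {s : W.fineSelmerInfty κ | p • s = 0}) :
    Finite (Y.X ⧸ (IwasawaAlgebra.augIdealP p • (⊤ : Submodule (IwasawaAlgebra p) Y.X))) :=
  IwasawaDual.finite_quotient_pSmul_of_finite_pTorsion Y.bijective Y.toDual_C_smul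
    exists_pow_smul_fineSelmerInfty_eq_zero hfin

end FineSelmerDualData

end WeierstrassCurve

end
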